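import Mathlib
import HarnessLib
import Literature.NumberTheory.LFunctions.RobertSargosTaylorBox
import Literature.NumberTheory.LFunctions.RobertSargosLemma4
import Literature.NumberTheory.LFunctions.RobertSargosDiophantine
import Literature.NumberTheory.LFunctions.RobertSargosFirstSpacing

/-!
# Robert–Sargos 2002, Steps 5–7: the double large sieve bound for `S̃(H₁)` — PROVED

Topic `Literature/NumberTheory/LFunctions`. Everything here is PROVED (no `sorry`, no named facts).
Steps 5, 6, 7 of the proof of Theorem 1 of O. Robert, P. Sargos, *A fourth derivative test for
exponential sums*, Compositio Math. 130 (2002) 275–292 (= arXiv:2307.03562v1): the triple sums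
`S̃(H₁) = ∑_r ∑_m |∑_{q,h,n} b_r(q,h,n) e(x_m P₁ + y_m P₂)|` ((4·17), `x_m = 2f''(m)`, `y_m = f'''(m)`)
are bounded by Lemma 4 (`RobertSargos.lemma4`, the double large sieve), with the second spacing count
`𝒩` bounded by Theorem 2 (`RobertSargos.theorem2`, Step 7: "the size of `RH₁²` shows that the terms
`rh²` and `r²h` in (4·12) may be inserted in the second member; thus `𝒩` is the number of integer
points lying in the domain (3·1) and satisfying (3·2) with `δHQ² ≍ 1/μ`") and the first spacing count
`ℬ` bounded by Step 6 (`RobertSargos.firstSpacingCount_le`).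

## Statements

Box coordinates (as delivered by Step 4, `RobertSargos.step4_partialSummation`): `y = (q', h', n')`,
`q = s(q'+1)` (`s = ±1`), `h = H₀(r) + h'`, `n = n' + 1`; `boxQ`, `boxH`, `boxN`, `bP₁`, `bP₂`, `qcls`
(the dyadic class `⌊log₂ |q|⌋`).
* `step7_count` — for every `ε > 0` a constant `C` such that for every class `c`,
  `∑_r #{(y,y') in class c : P₁ = P₁', |P₂ - P₂'| ≤ 1/μ} ≤ C((RNH₁Q)^{1+ε} + (RNH₁Q)^ε RN(1/μ + 4RH₁²))`.
* `step6_count` — `#{(m,m') ∈ J² : ‖2f''(m) - 2f''(m')‖ ≤ η₁, |f'''(m) - f'''(m')| ≤ η₂} ≤ ℬ(M, η₁, η₂)`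
  for `J ⊆ (c, c + M]`, from `firstSpacingCount_le` and the mean value theorem.
* `step567` — the combination through `lemma4`.

## References

* O. Robert, P. Sargos, *A fourth derivative test for exponential sums*, Compositio Math. 130 (2002),
  275–292, doi:10.1023/A:1014363224308 = arXiv:2307.03562v1 — §4 Steps 5–7, (4·17)–(4·25). [RobertSargos2002]
-/

noncomputable section

open Finset Set

namespace Literature.NumberTheory.LFunctions
namespace RobertSargos

open Literature.NumberTheory.LFunctions.VdC (e norm_e e_add DerivFamily)

/-! ### Box coordinates -/

/-- `q = s(q'+1)`. [cite: RobertSargos2002, Step 4] -/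
def boxQ (s : ℤ) (y : ℕ × ℕ × ℕ) : ℤ := s * ((y.1 : ℤ) + 1)
/-- `h = H₀ + h'`. [cite: RobertSargos2002, Step 4] -/
def boxH (H₀ : ℤ) (y : ℕ × ℕ × ℕ) : ℤ := H₀ + (y.2.1 : ℤ)
/-- `n = n' + 1`. [cite: RobertSargos2002, Step 4] -/
def boxN (y : ℕ × ℕ × ℕ) : ℤ := (y.2.2 : ℤ) + 1
/-- `P₁(r,q,h,n)` in box coordinates. [cite: RobertSargos2002, (4.12)] -/
def bP₁ (s H₀ r : ℤ) (y : ℕ × ℕ × ℕ) : ℤ := P₁ r (boxQ s y) (boxH H₀ y) (boxN y)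
/-- `P₂(r,q,h,n)` in box coordinates. [cite: RobertSargos2002, (4.12)] -/
def bP₂ (s H₀ r : ℤ) (y : ℕ × ℕ × ℕ) : ℤ := P₂ r (boxQ s y) (boxH H₀ y) (boxN y)
/-- The dyadic class of `|q| = q' + 1`. [cite: RobertSargos2002, (2.11)] -/
def qcls (y : ℕ × ℕ × ℕ) : ℕ := Nat.log 2 (y.1 + 1)

/-! ### Step 7: the count `𝒩` via Theorem 2 -/

set_option maxHeartbeats 1000000 in
open Classical in
/-- **Step 7 of [RS]**: the second spacing count of Lemma 4 is a count of Theorem 2 with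
`δHQ₁² = 1/μ + 4RH₁²` (the terms `rh², r²h` of `P₂` moved into `δ`), uniformly in the dyadic class.
[cite: RobertSargos2002, Step 7] -/
theorem step7_count {ε : ℝ} (hε : 0 < ε) : ∃ C : ℝ, 0 < C ∧
    ∀ (s : ℤ), (s = 1 ∨ s = -1) → ∀ (R Q N H₁ : ℕ), 1 ≤ R → 1 ≤ N → 2 * R ≤ H₁ →
    ∀ (Rs : Finset ℤ), (∀ r ∈ Rs, r ≠ 0 ∧ |r| < R) →
    ∀ (H₀ : ℤ → ℤ) (A' B' C' : ℤ → ℕ),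
      (∀ r ∈ Rs, (H₁ : ℤ) ≤ H₀ r ∧ H₀ r + B' r ≤ 2 * H₁ ∧ A' r + 1 ≤ Q ∧ C' r ≤ N) →
    ∀ (μ : ℝ), 0 < μ → ∀ c : ℕ,
      (∑ r ∈ Rs, (((((range (A' r) ×ˢ range (B' r) ×ˢ range (C' r)).filter (fun y => qcls y = c)) ×ˢ
          ((range (A' r) ×ˢ range (B' r) ×ˢ range (C' r)).filter (fun y => qcls y = c))).filter
          (fun yy => bP₁ s (H₀ r) r yy.1 = bP₁ s (H₀ r) r yy.2 ∧
            |((bP₂ s (H₀ r) r yy.1 : ℤ) : ℝ) - bP₂ s (H₀ r) r yy.2| ≤ 1 / μ)).card : ℝ)) ≤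
        C * (((R : ℝ) * N * H₁ * Q) ^ (1 + ε) +
          ((R : ℝ) * N * H₁ * Q) ^ ε * (R * N * (1 / μ + 4 * R * (H₁ : ℝ) ^ 2))) := by
  obtain ⟨C, hC0, hC⟩ := theorem2 hε
  refine ⟨C, hC0, ?_⟩
  intro s hs R Q N H₁ hR hN h2R Rs hRs H₀ A' B' C' hbox μ hμ c
  -- notation
  set Ys : ℤ → Finset (ℕ × ℕ × ℕ) := fun r => range (A' r) ×ˢ range (B' r) ×ˢ range (C' r) with hYs
  set Filt : ℤ → Finset ((ℕ × ℕ × ℕ) × (ℕ × ℕ × ℕ)) := fun r =>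
    (((Ys r).filter (fun y => qcls y = c)) ×ˢ ((Ys r).filter (fun y => qcls y = c))).filter
      (fun yy => bP₁ s (H₀ r) r yy.1 = bP₁ s (H₀ r) r yy.2 ∧
        |((bP₂ s (H₀ r) r yy.1 : ℤ) : ℝ) - bP₂ s (H₀ r) r yy.2| ≤ 1 / μ) with hFilt
  show (∑ r ∈ Rs, ((Filt r).card : ℝ)) ≤ _
  have hRr : (1 : ℝ) ≤ R := by exact_mod_cast hR
  have hNr : (1 : ℝ) ≤ N := by exact_mod_cast hN
  have hH1 : (2 : ℝ) * R ≤ H₁ := by exact_mod_cast h2R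
  have hHr : (1 : ℝ) ≤ H₁ := by linarith
  have hRHS0 : 0 ≤ C * (((R : ℝ) * N * H₁ * Q) ^ (1 + ε) +
      ((R : ℝ) * N * H₁ * Q) ^ ε * (R * N * (1 / μ + 4 * R * (H₁ : ℝ) ^ 2))) := by positivity
  -- the class size
  set Qc : ℕ := 2 ^ c with hQc
  have hQc1 : (1 : ℝ) ≤ Qc := by rw [hQc]; exact_mod_cast Nat.one_le_two_pow
  -- members of a class
  have hcls : ∀ y : ℕ × ℕ × ℕ, qcls y = c → Qc ≤ y.1 + 1 ∧ y.1 + 1 < 2 * Qc := by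
    intro y hy
    rw [qcls] at hy
    rw [hQc, ← hy]
    exact ⟨Nat.pow_log_le_self 2 (by omega), by rw [← pow_succ']; exact Nat.lt_pow_succ_log_self (by norm_num) _⟩
  -- if the class is beyond `Q`, everything is empty
  by_cases hcQ : Q < Qc + 1
  · have : ∀ r ∈ Rs, Filt r = ∅ := by
      intro r hr
      rw [hFilt]; simp only
      rw [Finset.filter_eq_empty_iff]
      intro yy hyy
      rw [Finset.mem_product, Finset.mem_filter, hYs] at hyy
      simp only [Finset.mem_product, Finset.mem_range] at hyy
      have h1 := (hcls _ hyy.1.2).1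
      have h2 := (hbox r hr).2.2.1
      omega
    rw [Finset.sum_congr rfl fun r hr => by rw [this r hr]]
    simp only [Finset.card_empty, Nat.cast_zero, Finset.sum_const_zero]
    exact hRHS0
  rw [not_lt] at hcQ
  have hQcQ : (Qc : ℝ) ≤ Q := by exact_mod_cast (by omega : Qc ≤ Q)
  -- `δ`
  set δ : ℝ := (1 / μ + 4 * R * (H₁ : ℝ) ^ 2) / (H₁ * (Qc : ℝ) ^ 2) with hδ
  have hδ0 : 0 < δ := by positivity
  have hδHQ : δ * H₁ * (Qc : ℝ) ^ 2 = 1 / μ + 4 * R * (H₁ : ℝ) ^ 2 := by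
    rw [hδ]; field_simp
  -- the septuples
  set ι : (Σ _ : ℤ, (ℕ × ℕ × ℕ) × (ℕ × ℕ × ℕ)) → ℤ × ℤ × ℤ × ℤ × ℤ × ℤ × ℤ := fun p =>
    (-p.1, boxQ s p.2.1, boxQ s p.2.2, boxH (H₀ p.1) p.2.1, boxH (H₀ p.1) p.2.2, boxN p.2.1, boxN p.2.2)
    with hι
  set Sg := Rs.sigma Filt with hSg
  have hs0 : s ≠ 0 := by rcases hs with h | h <;> simp [h]
  have hinj : Set.InjOn ι Sg := by
    rintro ⟨r, y, y'⟩ hp ⟨r₂, z, z'⟩ hp₂ heq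
    simp only [hι, Prod.mk.injEq, neg_inj, boxQ, boxH, boxN] at heq
    obtain ⟨rfl, h1, h2, h3, h4, h5, h6⟩ := heq
    have e1 : y.1 = z.1 := by
      have := mul_left_cancel₀ hs0 h1; omega
    have e2 : y'.1 = z'.1 := by
      have := mul_left_cancel₀ hs0 h2; omega
    have e3 : y.2.1 = z.2.1 := by omega
    have e4 : y'.2.1 = z'.2.1 := by omega
    have e5 : y.2.2 = z.2.2 := by omega
    have e6 : y'.2.2 = z'.2.2 := by omega
    have ey : y = z := Prod.ext e1 (Prod.ext e3 e5)
    have ey' : y' = z' := Prod.ext e2 (Prod.ext e4 e6)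
    subst ey; subst ey'; rfl
  have hcard : (∑ r ∈ Rs, ((Filt r).card : ℝ)) = ((Sg.image ι).card : ℝ) := by
    rw [Finset.card_image_of_injOn hinj, hSg, Finset.card_sigma]; push_cast; rfl
  rw [hcard]
  -- every septuple satisfies `NCond R Qc H₁ N δ`
  have hNC : ∀ p ∈ Sg.image ι, NCond R Qc H₁ N δ p.1 p.2.1 p.2.2.1 p.2.2.2.1 p.2.2.2.2.1 p.2.2.2.2.2.1
      p.2.2.2.2.2.2 := by
    intro p hp
    obtain ⟨⟨r, y, y'⟩, hmem, rfl⟩ := Finset.mem_image.mp hp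
    rw [hSg, Finset.mem_sigma] at hmem
    obtain ⟨hr, hyy⟩ := hmem
    rw [hFilt] at hyy; simp only at hyy
    rw [Finset.mem_filter, Finset.mem_product, Finset.mem_filter, Finset.mem_filter, hYs] at hyy
    simp only [Finset.mem_product, Finset.mem_range] at hyy
    obtain ⟨⟨⟨⟨hy1, hy2, hy3⟩, hyc⟩, ⟨⟨hy1', hy2', hy3'⟩, hyc'⟩⟩, hP1, hP2⟩ := hyy
    obtain ⟨hr0, hrR⟩ := hRs r hr
    obtain ⟨hH0, hHB, hAQ, hCN⟩ := hbox r hr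
    obtain ⟨c1, c2⟩ := hcls y hyc
    obtain ⟨c1', c2'⟩ := hcls y' hyc'
    show NCond R Qc H₁ N δ (-r) (boxQ s y) (boxQ s y') (boxH (H₀ r) y) (boxH (H₀ r) y') (boxN y) (boxN y')
    -- real forms
    have hsabs : |(s : ℝ)| = 1 := by rcases hs with h | h <;> simp [h]
    have habs : ∀ z : ℕ × ℕ × ℕ, |((boxQ s z : ℤ) : ℝ)| = (z.1 : ℝ) + 1 := by
      intro z
      rw [boxQ]; push_cast
      rw [abs_mul, hsabs, one_mul, abs_of_nonneg (by positivity)]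
    -- sizes of `h, h'`
    have hhlo : (H₁ : ℝ) ≤ ((boxH (H₀ r) y : ℤ) : ℝ) := by
      rw [boxH]; push_cast
      have : ((H₁ : ℤ) : ℝ) ≤ H₀ r := by exact_mod_cast hH0
      have h0 : (0 : ℝ) ≤ y.2.1 := by positivity
      push_cast at this; linarith
    have hhhi : ((boxH (H₀ r) y : ℤ) : ℝ) < 2 * H₁ := by
      rw [boxH]; push_cast
      have h1 : ((H₀ r + B' r : ℤ) : ℝ) ≤ 2 * H₁ := by exact_mod_cast hHB
      have h2 : (y.2.1 : ℝ) < B' r := by exact_mod_cast hy2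
      push_cast at h1; linarith
    have hhlo' : (H₁ : ℝ) ≤ ((boxH (H₀ r) y' : ℤ) : ℝ) := by
      rw [boxH]; push_cast
      have : ((H₁ : ℤ) : ℝ) ≤ H₀ r := by exact_mod_cast hH0
      have h0 : (0 : ℝ) ≤ y'.2.1 := by positivity
      push_cast at this; linarith
    have hhhi' : ((boxH (H₀ r) y' : ℤ) : ℝ) < 2 * H₁ := by
      rw [boxH]; push_cast
      have h1 : ((H₀ r + B' r : ℤ) : ℝ) ≤ 2 * H₁ := by exact_mod_cast hHB
      have h2 : (y'.2.1 : ℝ) < B' r := by exact_mod_cast hy2'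
      push_cast at h1; linarith
    have hrabs : |(r : ℝ)| ≤ R := by
      have : ((|r| : ℤ) : ℝ) < R := by exact_mod_cast hrR
      rw [Int.cast_abs] at this; exact this.le
    -- the quadratic inequality: `G = P₂ + r h² + r² h`
    have hquad : (|((-r * boxN y ^ 2 + 2 * boxH (H₀ r) y * boxQ s y * boxN y + boxH (H₀ r) y * boxQ s y ^ 2 -
        (-r * boxN y' ^ 2 + 2 * boxH (H₀ r) y' * boxQ s y' * boxN y' + boxH (H₀ r) y' * boxQ s y' ^ 2) : ℤ) : ℝ)|)
        ≤ δ * H₁ * (Qc : ℝ) ^ 2 := by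
      rw [hδHQ]
      set hh : ℤ := boxH (H₀ r) y with hhh
      set hh' : ℤ := boxH (H₀ r) y' with hhh'
      have hG : (-r * boxN y ^ 2 + 2 * hh * boxQ s y * boxN y + hh * boxQ s y ^ 2 -
          (-r * boxN y' ^ 2 + 2 * hh' * boxQ s y' * boxN y' + hh' * boxQ s y' ^ 2) : ℤ) =
          (bP₂ s (H₀ r) r y - bP₂ s (H₀ r) r y') + (r * (hh ^ 2 - hh' ^ 2) + r ^ 2 * (hh - hh')) := by
        rw [bP₂, bP₂, P₂, P₂, ← hhh, ← hhh']; ring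
      rw [hG]; push_cast
      have u1 : ((hh : ℝ)) ^ 2 ≤ (2 * (H₁ : ℝ)) ^ 2 := pow_le_pow_left₀ (by linarith) hhhi.le 2
      have u2 : (H₁ : ℝ) ^ 2 ≤ (hh : ℝ) ^ 2 := pow_le_pow_left₀ (by positivity) hhlo 2
      have u1' : ((hh' : ℝ)) ^ 2 ≤ (2 * (H₁ : ℝ)) ^ 2 := pow_le_pow_left₀ (by linarith) hhhi'.le 2
      have u2' : (H₁ : ℝ) ^ 2 ≤ (hh' : ℝ) ^ 2 := pow_le_pow_left₀ (by positivity) hhlo' 2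
      have hsq : |(hh : ℝ) ^ 2 - (hh' : ℝ) ^ 2| ≤ 3 * (H₁ : ℝ) ^ 2 := by
        rw [abs_le]; constructor <;> linarith
      have hlin : |(hh : ℝ) - hh'| ≤ H₁ := by rw [abs_le]; constructor <;> linarith
      have hR2 : (R : ℝ) ^ 2 ≤ R * H₁ / 2 := by nlinarith
      have hR2' : (R : ℝ) ^ 2 * H₁ ≤ R * (H₁ : ℝ) ^ 2 / 2 := by
        have := mul_le_mul_of_nonneg_right hR2 (by positivity : (0 : ℝ) ≤ H₁)
        calc (R : ℝ) ^ 2 * H₁ ≤ R * H₁ / 2 * H₁ := this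
          _ = R * (H₁ : ℝ) ^ 2 / 2 := by ring
      calc |((bP₂ s (H₀ r) r y : ℤ) : ℝ) - bP₂ s (H₀ r) r y' + ((r : ℝ) * ((hh : ℝ) ^ 2 - (hh' : ℝ) ^ 2) +
            (r : ℝ) ^ 2 * ((hh : ℝ) - hh'))|
          ≤ |((bP₂ s (H₀ r) r y : ℤ) : ℝ) - bP₂ s (H₀ r) r y'| + (|(r : ℝ) * ((hh : ℝ) ^ 2 - (hh' : ℝ) ^ 2)| +
            |(r : ℝ) ^ 2 * ((hh : ℝ) - hh')|) := (abs_add_le _ _).trans (add_le_add le_rfl (abs_add_le _ _))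
        _ ≤ 1 / μ + (R * (3 * (H₁ : ℝ) ^ 2) + R ^ 2 * H₁) := by
            refine add_le_add hP2 (add_le_add ?_ ?_)
            · rw [abs_mul]; exact mul_le_mul hrabs hsq (abs_nonneg _) (by positivity)
            · rw [abs_mul, abs_pow]
              refine mul_le_mul (pow_le_pow_left₀ (abs_nonneg _) hrabs 2) hlin (abs_nonneg _) (by positivity)
        _ ≤ 1 / μ + 4 * R * (H₁ : ℝ) ^ 2 := by
            have hpos : (0 : ℝ) ≤ R * (H₁ : ℝ) ^ 2 := by positivity
            linarith
    refine ⟨by simpa using hr0, ?_, ?_, ?_, ?_, ?_, ?_, hhlo, hhhi, hhlo', hhhi', ?_, ?_, ?_, ?_, ?_, hquad⟩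
    · push_cast; rw [abs_neg]; exact_mod_cast hrR
    · rw [habs]; exact_mod_cast c1
    · rw [habs]; exact_mod_cast c2
    · rw [habs]; exact_mod_cast c1'
    · rw [habs]; exact_mod_cast c2'
    · rw [boxQ, boxQ]
      have : s * ((y.1 : ℤ) + 1) * (s * ((y'.1 : ℤ) + 1)) = (s * s) * (((y.1 : ℤ) + 1) * ((y'.1 : ℤ) + 1)) := by ring
      rw [this]
      refine mul_pos ?_ (by positivity)
      rcases hs with h | h <;> simp [h]
    · rw [boxN]; omega
    · rw [boxN]; push_cast
      have : (y.2.2 : ℝ) + 1 ≤ C' r := by exact_mod_cast hy3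
      have h2 : (C' r : ℝ) ≤ N := by exact_mod_cast hCN
      linarith
    · rw [boxN]; omega
    · rw [boxN]; push_cast
      have : (y'.2.2 : ℝ) + 1 ≤ C' r := by exact_mod_cast hy3'
      have h2 : (C' r : ℝ) ≤ N := by exact_mod_cast hCN
      linarith
    · -- the linear equation from `P₁ = P₁'`
      rw [bP₁, bP₁, P₁, P₁] at hP1
      linarith
  have hmain := hC R Qc H₁ N δ hRr hQc1 hNr hH1 hδ0 (Sg.image ι) hNC
  refine hmain.trans ?_
  -- the final algebra
  set X : ℝ := (R : ℝ) * N * H₁ with hX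
  have hX0 : 0 < X := by positivity
  have hXQc : 0 < X * Qc := by positivity
  have e1 : (R : ℝ) * N * H₁ * Qc = X * Qc := by rw [hX]
  rw [e1]
  have h1 : (X * Qc) ^ (1 + ε) ≤ (X * Q) ^ (1 + ε) :=
    Real.rpow_le_rpow (by positivity) (by nlinarith) (by positivity)
  have h2 : (X * Qc) ^ (1 + ε) * (δ * Qc) = (X * Qc) ^ ε * (R * N * (1 / μ + 4 * R * (H₁ : ℝ) ^ 2)) := by
    rw [Real.rpow_add hXQc, Real.rpow_one, hδ, hX]
    field_simp
  have h3 : (X * Qc) ^ ε ≤ (X * Q) ^ ε := Real.rpow_le_rpow (by positivity) (by nlinarith) hε.le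
  have h4 : 0 ≤ (R : ℝ) * N * (1 / μ + 4 * R * (H₁ : ℝ) ^ 2) := by positivity
  calc C * (X * ↑Qc) ^ (1 + ε) * (1 + δ * ↑Qc)
      = C * ((X * Qc) ^ (1 + ε) + (X * Qc) ^ (1 + ε) * (δ * Qc)) := by ring
    _ = C * ((X * Qc) ^ (1 + ε) + (X * Qc) ^ ε * (R * N * (1 / μ + 4 * R * (H₁ : ℝ) ^ 2))) := by rw [h2]
    _ ≤ C * ((X * Q) ^ (1 + ε) + (X * Q) ^ ε * (R * N * (1 / μ + 4 * R * (H₁ : ℝ) ^ 2))) := by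
        apply mul_le_mul_of_nonneg_left _ hC0.le
        exact add_le_add h1 (mul_le_mul_of_nonneg_right h3 h4)
    _ = _ := by rw [hX]

/-! ### Step 6: the count `ℬ` -/

open Classical in
/-- **Step 6 of [RS]** in the setting of a derivative family: for `J ⊆ (c, c + M]` with
`[c + 1, c + M] ⊆ [a, b]` and `λ ≤ D 4 ≤ Λ`, the number of pairs `(m, m') ∈ J²` with
`‖2f''(m) - 2f''(m')‖ ≤ η₁` and `|f'''(m) - f'''(m')| ≤ η₂` is at most
`M + 2(2C₀Mη₁K + 2C₀λMK² + (2η₁+1)(η₁/λ)(1 + log K) + (2η₁+1)K)`, `K = ⌊η₂/λ⌋`, `C₀ = Λ/λ`.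
[cite: RobertSargos2002, Step 6, (4.24)] -/
theorem step6_count {D : ℕ → ℝ → ℝ} {a b lam Λ : ℝ} (hD : DerivFamily D a b 4)
    (hb4 : ∀ t ∈ Icc a b, lam ≤ D 4 t ∧ D 4 t ≤ Λ) (hlam : 0 < lam) (hΛ : lam ≤ Λ)
    (c : ℤ) (M : ℕ) (hM : 1 ≤ M) (hca : a ≤ (c : ℝ) + 1) (hcb : (c : ℝ) + M ≤ b)
    (J : Finset ℤ) (hJ : ∀ m ∈ J, c + 1 ≤ m ∧ m ≤ c + M) {η₁ η₂ : ℝ} (hη₁ : 0 ≤ η₁) (hη₂ : 0 ≤ η₂) :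
    (((J ×ˢ J).filter (fun mm => (∃ k : ℤ, |2 * D 2 mm.1 - 2 * D 2 mm.2 - k| ≤ η₁) ∧
        |D 3 mm.1 - D 3 mm.2| ≤ η₂)).card : ℝ) ≤
      M + 2 * (2 * (Λ / lam) * M * η₁ * ⌊η₂ / lam⌋₊ + 2 * (Λ / lam) * lam * M * (⌊η₂ / lam⌋₊ : ℝ) ^ 2 +
        (2 * η₁ + 1) * (η₁ / lam) * (1 + Real.log ⌊η₂ / lam⌋₊) + (2 * η₁ + 1) * ⌊η₂ / lam⌋₊) := by
  set φ : ℝ → ℝ := fun t => 2 * D 2 (t + c) with hφ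
  set ψ : ℝ → ℝ := fun t => D 3 (t + c) with hψ
  have hC₀ : 1 ≤ Λ / lam := by rwa [le_div_iff₀ hlam, one_mul]
  have hMr : (1 : ℝ) ≤ M := by exact_mod_cast hM
  have hΛeq : Λ = Λ / lam * lam := by field_simp
  -- the translated pairs
  set Pset := (J ×ˢ J).filter (fun mm => (∃ k : ℤ, |2 * D 2 mm.1 - 2 * D 2 mm.2 - k| ≤ η₁) ∧
    |D 3 mm.1 - D 3 mm.2| ≤ η₂) with hPset
  set τ : ℤ × ℤ → ℤ × ℤ := fun mm => (mm.1 - c, mm.2 - c) with hτ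
  have hinj : Set.InjOn τ Pset := by
    intro p _ p' _ h
    simp only [hτ, Prod.mk.injEq] at h
    exact Prod.ext (by omega) (by omega)
  rw [← Finset.card_image_of_injOn hinj]
  have hψ' : ∀ x y : ℝ, 1 ≤ x → x ≤ y → y ≤ M → lam * (y - x) ≤ ψ y - ψ x ∧ ψ y - ψ x ≤ Λ / lam * lam * (y - x) := by
    intro x y hx hxy hy
    rw [← hΛeq]
    have := D3_incr hD hb4 (x := x + c) (y := y + c) (by linarith) (by linarith) (by linarith)
    simp only [hψ]
    constructor <;> nlinarith [this.1, this.2]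
  have hφ' : ∀ k : ℤ, 1 ≤ k → ∀ x y : ℝ, 1 ≤ x → x ≤ y → y + k ≤ M →
      2 * k * lam * (y - x) ≤ (φ (y + k) - φ y) - (φ (x + k) - φ x) ∧
        (φ (y + k) - φ y) - (φ (x + k) - φ x) ≤ 2 * (Λ / lam) * k * lam * (y - x) := by
    intro k hk x y hx hxy hyk
    have hk0 : (0 : ℝ) ≤ k := by exact_mod_cast (by omega : (0 : ℤ) ≤ k)
    have := twoD2_incr hD hb4 (k := (k : ℝ)) (x := x + c) (y := y + c) hk0 (by linarith) (by linarith)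
      (by linarith)
    simp only [hφ]
    have e1 : y + k + c = y + c + k := by ring
    have e2 : x + k + c = x + c + k := by ring
    rw [e1, e2]
    have e3 : 2 * (Λ / lam) * k * lam * (y - x) = 2 * k * Λ * (y + c - (x + c)) := by
      rw [hΛeq]; field_simp; ring
    have e4 : 2 * k * lam * (y - x) = 2 * k * lam * (y + c - (x + c)) := by ring
    rw [e3, e4]
    exact this
  have key := firstSpacingCount_le hlam hC₀ hMr hη₁ hη₂ hψ' hφ' (Pset.image τ) ?_
  · exact key
  intro p hp
  obtain ⟨mm, hmm, rfl⟩ := Finset.mem_image.mp hp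
  rw [hPset, Finset.mem_filter, Finset.mem_product] at hmm
  obtain ⟨⟨hm1, hm2⟩, ⟨k, hk⟩, h3⟩ := hmm
  obtain ⟨a1, a2⟩ := hJ _ hm1
  obtain ⟨b1, b2⟩ := hJ _ hm2
  simp only [hτ, hφ, hψ]
  push_cast
  refine ⟨?_, ?_, ?_, ?_, ⟨k, ?_⟩, ?_⟩
  · have : ((c + 1 : ℤ) : ℝ) ≤ mm.1 := by exact_mod_cast a1
    push_cast at this; linarith
  · have : ((mm.1 : ℤ) : ℝ) ≤ ((c + M : ℤ) : ℝ) := by exact_mod_cast a2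
    push_cast at this; linarith
  · have : ((c + 1 : ℤ) : ℝ) ≤ mm.2 := by exact_mod_cast b1
    push_cast at this; linarith
  · have : ((mm.2 : ℤ) : ℝ) ≤ ((c + M : ℤ) : ℝ) := by exact_mod_cast b2
    push_cast at this; linarith
  · have e1 : (mm.1 : ℝ) - c + c = mm.1 := by ring
    have e2 : (mm.2 : ℝ) - c + c = mm.2 := by ring
    rw [e1, e2]; exact hk
  · have e1 : (mm.1 : ℝ) - c + c = mm.1 := by ring
    have e2 : (mm.2 : ℝ) - c + c = mm.2 := by ring
    rw [e1, e2]; exact h3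

/-! ### Steps 5–7 combined -/

set_option maxHeartbeats 1000000 in
open Classical in
/-- **Steps 5, 6, 7 of [RS] combined**: Lemma 4 (`RobertSargos.lemma4`) for the triple sums in box
coordinates, with `X₁ = 3QH₁ ≥ |P₁|`, `X₂ = 13H₁Q² ≥ |P₂|`, `μ = ΛM ≥ |f'''(m) - f'''(m')|`
(`R ≤ H₁/2`, `N ≤ Q`, `H₁ ≤ Q`), the count `𝒩` bounded by `step7_count` (Theorem 2) and the count `ℬ`
bounded by `step6_count` (Step 6): for every `ε > 0` there is `C = C(ε) > 0` with
`(∑_r ∑_{m ∈ J} |∑_y β_r(y) e(2f''(m) P₁ + f'''(m) P₂)|)² ≤ 624² (log₂ Q + 1)² #Rs (1 + X₁)(1 + μX₂) 𝒩 ℬ`.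
[cite: RobertSargos2002, Steps 5–7, (4.19)–(4.26)] -/
theorem step567 {ε : ℝ} (hε : 0 < ε) : ∃ C : ℝ, 0 < C ∧
    ∀ (D : ℕ → ℝ → ℝ) (a b lam Λ : ℝ), DerivFamily D a b 4 →
      (∀ t ∈ Icc a b, lam ≤ D 4 t ∧ D 4 t ≤ Λ) → 0 < lam → lam ≤ Λ →
    ∀ (s : ℤ), (s = 1 ∨ s = -1) →
    ∀ (R Q N H₁ : ℕ), 1 ≤ R → 1 ≤ N → 2 * R ≤ H₁ → N ≤ Q → H₁ ≤ Q →
    ∀ (Rs : Finset ℤ), (∀ r ∈ Rs, r ≠ 0 ∧ |r| < R) →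
    ∀ (A' B' C' : ℤ → ℕ), (∀ r ∈ Rs, A' r + 1 ≤ Q ∧ B' r ≤ H₁ ∧ C' r ≤ N) →
    ∀ (c : ℤ) (M : ℕ), 1 ≤ M → a ≤ (c : ℝ) + 1 → (c : ℝ) + M ≤ b →
    ∀ (J : Finset ℤ), (∀ m ∈ J, c + 1 ≤ m ∧ m ≤ c + M) →
    ∀ (β : ℤ → ℕ × ℕ × ℕ → ℂ), (∀ r y, ‖β r y‖ ≤ 1) →
      (∑ r ∈ Rs, ∑ m ∈ J, ‖∑ y ∈ range (A' r) ×ˢ range (B' r) ×ˢ range (C' r),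
          β r y * e ((2 * D 2 m) * (bP₁ s H₁ r y : ℤ) + D 3 m * ((bP₂ s H₁ r y : ℤ) : ℝ))‖) ^ 2 ≤
        624 ^ 2 * ((Nat.log 2 Q : ℝ) + 1) ^ 2 * Rs.card *
          ((1 + 3 * (Q : ℝ) * H₁) * (1 + Λ * M * (13 * (H₁ : ℝ) * (Q : ℝ) ^ 2))) *
          (C * (((R : ℝ) * N * H₁ * Q) ^ (1 + ε) +
            ((R : ℝ) * N * H₁ * Q) ^ ε * (R * N * (1 / (Λ * M) + 4 * R * (H₁ : ℝ) ^ 2)))) *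
          (M + 2 * (2 * (Λ / lam) * M * (2 * (3 * (Q : ℝ) * H₁))⁻¹ * ⌊(2 * (13 * (H₁ : ℝ) * (Q : ℝ) ^ 2))⁻¹ / lam⌋₊ +
            2 * (Λ / lam) * lam * M * (⌊(2 * (13 * (H₁ : ℝ) * (Q : ℝ) ^ 2))⁻¹ / lam⌋₊ : ℝ) ^ 2 +
            (2 * (2 * (3 * (Q : ℝ) * H₁))⁻¹ + 1) * ((2 * (3 * (Q : ℝ) * H₁))⁻¹ / lam) *
              (1 + Real.log ⌊(2 * (13 * (H₁ : ℝ) * (Q : ℝ) ^ 2))⁻¹ / lam⌋₊) +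
            (2 * (2 * (3 * (Q : ℝ) * H₁))⁻¹ + 1) * ⌊(2 * (13 * (H₁ : ℝ) * (Q : ℝ) ^ 2))⁻¹ / lam⌋₊)) := by
  obtain ⟨C, hC0, hC⟩ := step7_count hε
  refine ⟨C, hC0, ?_⟩
  intro D a b lam Λ hD hb4 hlam hΛ s hs R Q N H₁ hR hN h2R hNQ hHQ Rs hRs A' B' C' hbox c M hM hca hcb J hJ β hβ
  -- the parameters of Lemma 4
  set X₁ : ℝ := 3 * (Q : ℝ) * H₁ with hX₁
  set X₂ : ℝ := 13 * (H₁ : ℝ) * (Q : ℝ) ^ 2 with hX₂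
  set μ : ℝ := Λ * M with hμ
  have hRr : (1 : ℝ) ≤ R := by exact_mod_cast hR
  have hH2R : (2 : ℝ) * R ≤ H₁ := by exact_mod_cast h2R
  have hHr : (1 : ℝ) ≤ H₁ := by linarith
  have hHQr : (H₁ : ℝ) ≤ Q := by exact_mod_cast hHQ
  have hNQr : (N : ℝ) ≤ Q := by exact_mod_cast hNQ
  have hQr : (1 : ℝ) ≤ Q := le_trans hHr hHQr
  have hMr : (1 : ℝ) ≤ M := by exact_mod_cast hM
  have hΛ0 : 0 < Λ := lt_of_lt_of_le hlam hΛ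
  have hX₁0 : 0 < X₁ := by positivity
  have hX₂0 : 0 < X₂ := by positivity
  have hμ0 : 0 < μ := by positivity
  have hRH : (R : ℝ) ≤ H₁ := by linarith
  -- the data of Lemma 4
  have key := lemma4 (ρ := ℤ) (σ := ℕ × ℕ × ℕ) (τ := ℤ) Rs
    (fun r => range (A' r) ×ˢ range (B' r) ×ˢ range (C' r)) J
    (fun r y => bP₁ s H₁ r y) (fun r y => ((bP₂ s H₁ r y : ℤ) : ℝ)) β (fun m => 2 * D 2 m) (fun m => D 3 m)
    (fun _ y => qcls y) (Nat.log 2 Q + 1) hX₁0 hX₂0 hμ0 (fun r _ y _ => hβ r y) ?_ ?_ ?_ ?_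
    (Nv := C * (((R : ℝ) * N * H₁ * Q) ^ (1 + ε) +
      ((R : ℝ) * N * H₁ * Q) ^ ε * (R * N * (1 / μ + 4 * R * (H₁ : ℝ) ^ 2))))
    (Bv := M + 2 * (2 * (Λ / lam) * M * (2 * X₁)⁻¹ * ⌊(2 * X₂)⁻¹ / lam⌋₊ +
      2 * (Λ / lam) * lam * M * (⌊(2 * X₂)⁻¹ / lam⌋₊ : ℝ) ^ 2 +
      (2 * (2 * X₁)⁻¹ + 1) * ((2 * X₁)⁻¹ / lam) * (1 + Real.log ⌊(2 * X₂)⁻¹ / lam⌋₊) +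
      (2 * (2 * X₁)⁻¹ + 1) * ⌊(2 * X₂)⁻¹ / lam⌋₊)) ?_ ?_
  · -- the conclusion
    have hcard : ((Nat.log 2 Q + 1 : ℕ) : ℝ) = (Nat.log 2 Q : ℝ) + 1 := by push_cast; ring
    rw [hcard] at key
    exact key
  · -- classes are `< log₂ Q + 1`
    intro r hr y hy
    simp only [Finset.mem_product, Finset.mem_range] at hy
    have h1 : y.1 + 1 ≤ Q := by have := (hbox r hr).1; omega
    show Nat.log 2 (y.1 + 1) < Nat.log 2 Q + 1
    exact Nat.lt_succ_of_le (Nat.log_mono_right h1)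
  · -- `|P₁| ≤ 3QH₁`
    intro r hr y hy
    simp only [Finset.mem_product, Finset.mem_range] at hy
    obtain ⟨hy1, hy2, hy3⟩ := hy
    obtain ⟨hA, hB, hCN⟩ := hbox r hr
    obtain ⟨hr0, hrR⟩ := hRs r hr
    show |((bP₁ s H₁ r y : ℤ) : ℝ)| ≤ X₁
    rw [bP₁, P₁, boxQ, boxH, boxN]; push_cast
    have hsabs : |(s : ℝ)| = 1 := by rcases hs with h | h <;> simp [h]
    have hq : |(s : ℝ) * ((y.1 : ℝ) + 1)| ≤ Q := by
      rw [abs_mul, hsabs, one_mul, abs_of_nonneg (by positivity)]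
      exact_mod_cast (by omega : y.1 + 1 ≤ Q)
    have hh : |(H₁ : ℝ) + y.2.1| ≤ 2 * H₁ := by
      rw [abs_of_nonneg (by positivity)]
      have : (y.2.1 : ℝ) ≤ H₁ := by exact_mod_cast (by omega : y.2.1 ≤ H₁)
      linarith
    have hn : |(y.2.2 : ℝ) + 1| ≤ N := by
      rw [abs_of_nonneg (by positivity)]
      exact_mod_cast (by omega : y.2.2 + 1 ≤ N)
    have hrabs : |(r : ℝ)| ≤ R := by
      have : ((|r| : ℤ) : ℝ) < R := by exact_mod_cast hrR
      rw [Int.cast_abs] at this; exact this.le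
    calc |((H₁ : ℝ) + y.2.1) * ((s : ℝ) * ((y.1 : ℝ) + 1)) - (r : ℝ) * ((y.2.2 : ℝ) + 1)|
        ≤ |((H₁ : ℝ) + y.2.1) * ((s : ℝ) * ((y.1 : ℝ) + 1))| + |(r : ℝ) * ((y.2.2 : ℝ) + 1)| := abs_sub _ _
      _ = |(H₁ : ℝ) + y.2.1| * |(s : ℝ) * ((y.1 : ℝ) + 1)| + |(r : ℝ)| * |(y.2.2 : ℝ) + 1| := by
          rw [abs_mul ((H₁ : ℝ) + y.2.1), abs_mul (r : ℝ)]
      _ ≤ 2 * H₁ * Q + R * N := add_le_add (mul_le_mul hh hq (abs_nonneg _) (by positivity))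
          (mul_le_mul hrabs hn (abs_nonneg _) (by positivity))
      _ ≤ 2 * H₁ * Q + H₁ * Q := by
          have := mul_le_mul hRH hNQr (by positivity) (by positivity); linarith
      _ = X₁ := by rw [hX₁]; ring
  · -- `|P₂| ≤ 13H₁Q²`
    intro r hr y hy
    simp only [Finset.mem_product, Finset.mem_range] at hy
    obtain ⟨hy1, hy2, hy3⟩ := hy
    obtain ⟨hA, hB, hCN⟩ := hbox r hr
    obtain ⟨hr0, hrR⟩ := hRs r hr
    show |((bP₂ s H₁ r y : ℤ) : ℝ)| ≤ X₂
    rw [bP₂, P₂, boxQ, boxH, boxN]; push_cast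
    set qq : ℝ := (s : ℝ) * ((y.1 : ℝ) + 1) with hqq
    set hh : ℝ := (H₁ : ℝ) + y.2.1 with hhh
    set nn : ℝ := (y.2.2 : ℝ) + 1 with hnn
    have hsabs : |(s : ℝ)| = 1 := by rcases hs with h | h <;> simp [h]
    have hq : |qq| ≤ Q := by
      rw [hqq, abs_mul, hsabs, one_mul, abs_of_nonneg (by positivity)]
      exact_mod_cast (by omega : y.1 + 1 ≤ Q)
    have hh0 : 0 ≤ hh := by positivity
    have hh2 : hh ≤ 2 * H₁ := by
      have : (y.2.1 : ℝ) ≤ H₁ := by exact_mod_cast (by omega : y.2.1 ≤ H₁)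
      rw [hhh]; linarith
    have habh : |hh| ≤ 2 * H₁ := by rw [abs_of_nonneg hh0]; exact hh2
    have hn0 : 0 ≤ nn := by positivity
    have hnN : nn ≤ Q := by
      have : (y.2.2 : ℝ) + 1 ≤ N := by exact_mod_cast (by omega : y.2.2 + 1 ≤ N)
      rw [hnn]; linarith
    have habn : |nn| ≤ Q := by rw [abs_of_nonneg hn0]; exact hnN
    have hrabs : |(r : ℝ)| ≤ H₁ := by
      have : ((|r| : ℤ) : ℝ) < R := by exact_mod_cast hrR
      rw [Int.cast_abs] at this; linarith
    have hQ0 : (0 : ℝ) ≤ Q := by positivity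
    have hH0 : (0 : ℝ) ≤ H₁ := by positivity
    have hq2 : |qq| ^ 2 ≤ (Q : ℝ) ^ 2 := pow_le_pow_left₀ (abs_nonneg _) hq 2
    have hn2 : |nn| ^ 2 ≤ (Q : ℝ) ^ 2 := pow_le_pow_left₀ (abs_nonneg _) habn 2
    have hh2' : |hh| ^ 2 ≤ (2 * (H₁ : ℝ)) ^ 2 := pow_le_pow_left₀ (abs_nonneg _) habh 2
    have hr2 : |(r : ℝ)| ^ 2 ≤ (H₁ : ℝ) ^ 2 := pow_le_pow_left₀ (abs_nonneg _) hrabs 2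
    have hH1Q : (H₁ : ℝ) ^ 2 ≤ (Q : ℝ) ^ 2 := pow_le_pow_left₀ hH0 hHQr 2
    have t1 : |hh * qq ^ 2| ≤ 2 * H₁ * (Q : ℝ) ^ 2 := by
      rw [abs_mul, abs_pow]; exact mul_le_mul habh hq2 (by positivity) (by positivity)
    have t2 : |2 * hh * qq * nn| ≤ 2 * (2 * H₁) * Q * Q := by
      rw [abs_mul, abs_mul, abs_mul, abs_two]
      refine mul_le_mul (mul_le_mul (mul_le_mul_of_nonneg_left habh (by norm_num)) hq (abs_nonneg _)
        (by positivity)) habn (abs_nonneg _) (by positivity)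
    have t3 : |(r : ℝ) * nn ^ 2| ≤ H₁ * (Q : ℝ) ^ 2 := by
      rw [abs_mul, abs_pow]; exact mul_le_mul hrabs hn2 (by positivity) (by positivity)
    have t4 : |(r : ℝ) * hh ^ 2| ≤ H₁ * (2 * (H₁ : ℝ)) ^ 2 := by
      rw [abs_mul, abs_pow]; exact mul_le_mul hrabs hh2' (by positivity) (by positivity)
    have t5 : |(r : ℝ) ^ 2 * hh| ≤ (H₁ : ℝ) ^ 2 * (2 * H₁) := by
      rw [abs_mul, abs_pow]; exact mul_le_mul hr2 habh (abs_nonneg _) (by positivity)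
    calc |hh * qq ^ 2 + 2 * hh * qq * nn - (r : ℝ) * nn ^ 2 - (r : ℝ) * hh ^ 2 - (r : ℝ) ^ 2 * hh|
        ≤ |hh * qq ^ 2| + |2 * hh * qq * nn| + |(r : ℝ) * nn ^ 2| + |(r : ℝ) * hh ^ 2| + |(r : ℝ) ^ 2 * hh| := by
          have a1 := abs_sub (hh * qq ^ 2 + 2 * hh * qq * nn - (r : ℝ) * nn ^ 2 - (r : ℝ) * hh ^ 2) ((r : ℝ) ^ 2 * hh)
          have a2 := abs_sub (hh * qq ^ 2 + 2 * hh * qq * nn - (r : ℝ) * nn ^ 2) ((r : ℝ) * hh ^ 2)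
          have a3 := abs_sub (hh * qq ^ 2 + 2 * hh * qq * nn) ((r : ℝ) * nn ^ 2)
          have a4 := abs_add_le (hh * qq ^ 2) (2 * hh * qq * nn)
          linarith
      _ ≤ 2 * H₁ * (Q : ℝ) ^ 2 + 2 * (2 * H₁) * Q * Q + H₁ * (Q : ℝ) ^ 2 + H₁ * (2 * (H₁ : ℝ)) ^ 2 +
            (H₁ : ℝ) ^ 2 * (2 * H₁) := by linarith
      _ ≤ X₂ := by
          rw [hX₂]
          have h6 : (H₁ : ℝ) * (H₁ : ℝ) ^ 2 ≤ H₁ * (Q : ℝ) ^ 2 := mul_le_mul_of_nonneg_left hH1Q hH0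
          have e6 : 2 * H₁ * (Q : ℝ) ^ 2 + 2 * (2 * H₁) * Q * Q + H₁ * (Q : ℝ) ^ 2 + H₁ * (2 * (H₁ : ℝ)) ^ 2 +
              (H₁ : ℝ) ^ 2 * (2 * H₁) = 7 * ((H₁ : ℝ) * (Q : ℝ) ^ 2) + 6 * ((H₁ : ℝ) * (H₁ : ℝ) ^ 2) := by ring
          rw [e6]; linarith
  · -- `|y_m - y_{m'}| ≤ ΛM`
    intro m hm m' hm'
    obtain ⟨h1, h2⟩ := hJ m hm
    obtain ⟨h1', h2'⟩ := hJ m' hm'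
    have c1 : ((c + 1 : ℤ) : ℝ) ≤ m := by exact_mod_cast h1
    have c2 : ((m : ℤ) : ℝ) ≤ ((c + M : ℤ) : ℝ) := by exact_mod_cast h2
    have c1' : ((c + 1 : ℤ) : ℝ) ≤ m' := by exact_mod_cast h1'
    have c2' : ((m' : ℤ) : ℝ) ≤ ((c + M : ℤ) : ℝ) := by exact_mod_cast h2'
    push_cast at c1 c2 c1' c2'
    have hmI : (m : ℝ) ∈ Icc a b := ⟨by linarith, by linarith⟩
    have hmI' : (m' : ℝ) ∈ Icc a b := ⟨by linarith, by linarith⟩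
    have hΛabs : ∀ t ∈ Icc a b, |D 4 t| ≤ Λ := fun t ht => by
      rw [abs_le]; constructor <;> linarith [(hb4 t ht).1, (hb4 t ht).2]
    have := abs_D3_sub_le hD hΛabs hmI' hmI
    show |D 3 m - D 3 m'| ≤ μ
    refine this.trans ?_
    rw [hμ]
    refine mul_le_mul_of_nonneg_left ?_ hΛ0.le
    rw [abs_le]; constructor <;> linarith
  · -- the count `𝒩` (Step 7)
    intro cl _
    have hbox' : ∀ r ∈ Rs, ((H₁ : ℕ) : ℤ) ≤ (H₁ : ℤ) ∧ (H₁ : ℤ) + B' r ≤ 2 * H₁ ∧ A' r + 1 ≤ Q ∧ C' r ≤ N := by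
      intro r hr
      obtain ⟨hA, hB, hCN⟩ := hbox r hr
      exact ⟨le_rfl, by omega, hA, hCN⟩
    have := hC s hs R Q N H₁ hR hN h2R Rs hRs (fun _ => (H₁ : ℤ)) A' B' C' hbox' μ hμ0 cl
    exact this
  · -- the count `ℬ` (Step 6)
    have := step6_count hD hb4 hlam hΛ c M hM hca hcb J hJ (η₁ := (2 * X₁)⁻¹) (η₂ := (2 * X₂)⁻¹)
      (by positivity) (by positivity)
    exact this

end RobertSargos
end Literature.NumberTheory.LFunctions

end
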